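import Summits.QuantumFields.YangMills.Theorems.LangevinControlUVFemtoCurvatureTwoPointCDefsCore
import Summits.QuantumFields.YangMills.Theorems.LangevinControlUVFemtoCurvatureTwoPointCSplitBridge
import Summits.QuantumFields.YangMills.Theorems.LangevinControlUVFemtoCurvatureTwoPointCStubLongCovNonnegSymm
import Summits.QuantumFields.YangMills.Theorems.LangevinControlUVFemtoCurvatureTwoPointCStubLongLogConvex
import Summits.QuantumFields.YangMills.Theorems.LangevinControlUVFemtoCurvatureTwoPointCStubAntitoneOfLogConvex
import Summits.QuantumFields.YangMills.Theorems.LangevinControlUVFemtoCurvatureTwoPointCStubCoreBridge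

/-!
# Route `LangevinControlUV`, crux `FemtoCurvatureTwoPointC` (stmt-QuantumFields-16204), line `Sketch` — reshape v6 bridge:
# interior profiles ⇒ `AFProfilesBigAt r` ⇒ the crux

Continuation lead `prover-line-stmt-QuantumFields-16204-c4-0`, cycle 6 (vocabulary `…CDefsCore`, p129672). For EVERY compact `G` (any
Borel structure) and every lattice representation `r`:

  `AFProfilesCoreAt r → AFProfilesBigAt r`   (`afProfilesBigAt_of_afProfilesCoreAt`),

hence `AFProfilesCore → AFProfilesBig` and `AFProfilesCore → SmallTorusVarianceLaw → FemtoCurvatureTwoPointC`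
(`femtoCurvatureTwoPointC_of_core_of_small`, registered sub-goal) through the v5 bridge `femtoCurvatureTwoPointC_of_big_of_small`
(p127987). Ingredients, all landed this cycle (worker wave, `--supports stmt-QuantumFields-16204`):

* `stub_longCovNonnegSymm` (p130109) — the LONGITUDINAL profile `g_L(s) = Cov_{L,β}(P_0^{01}, P_{s e₀}^{01})` is `≥ 0` and
  `g_L(L − s) = g_L(s)` (reflection positivity for mirror pairs of TEMPORAL plaquettes: link / site / odd-torus mirrors);
* `stub_longLogConvex` (p130056) — `g_L(c)² ≤ g_L(c−1) g_L(c+1)`, `2 ≤ c ≤ L − 2` (RP Cauchy–Schwarz for temporal plaquette pairs);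
* `stub_antitoneOfLogConvex` (p129867) — real sequences: non-negative + symmetric + log-convex ⇒ non-increasing on `[1, L/2]`;
* `stub_coreBridge` (p130007) — bookkeeping: with the longitudinal monotonicity as hypotheses, `AFProfilesCoreAt r` (interior
  ranges `8s ≤ L` for the two upper profile clauses) gives `AFProfilesBigAt r` (ranges `2s ≤ L`): for `L/8 < s ≤ L/2` the clauses at
  `s₀ = ⌊L/8⌋`, antitonicity (transverse: `FemtoCurvatureTwoPoint.stub_axisProfileAntitone`, `…stub_axisCovNonneg`; longitudinal: the
  three stubs above), `(s/s₀)⁸ < 8⁸` and one octave of comparability `u(8s₀)² ≤ 4u(L)²` (`stub_windowRatio`); window height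
  `min u₀ (1/(4(|κ₂|+1)))`, threshold `max β₀ 1`, constant `2²⁶·max C 0`.

Nothing is asserted; no `sorry`. The remaining open statements of the line are `AFProfilesCore` (physics) and the Literature named
fact `WilsonPartitionRegularVariation` (small tori, via `smallTorusVarianceLaw_of_RV`, p128260).
-/

set_option autoImplicit false

noncomputable section

open Filter Topology MeasureTheory
open Literature.MathematicalPhysics.QuantumFieldTheory

namespace Summit.QuantumFields.YangMills.Theorems.FemtoCurvatureTwoPointC

/-- **The longitudinal profile of a lattice representation is non-negative**: for every torus, `β ≥ 0`, `s`:
`0 ≤ Cov_{L,β}(P_0^{01}, P_{s e₀}^{01})`, `P = N − Re tr r.ρ(U_p)` (from `stub_longCovNonnegSymm`: reflection positivity). [folklore] -/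
theorem longCovNonneg_rep {G : Type} [Group G] [TopologicalSpace G] [IsTopologicalGroup G] [CompactSpace G]
    [MeasurableSpace G] [BorelSpace G] (r : LatticeRep G) :
    ∀ (L : ℕ) [NeZero L] (β : ℝ), 0 ≤ β → ∀ s : ℕ, 0 ≤ wilsonExpectation r.ρ β (fun U : GaugeConfig 4 L G => ((r.N : ℝ) - (r.ρ (plaquetteHolonomy U 0 0 1)).trace.re) * ((r.N : ℝ) - (r.ρ (plaquetteHolonomy U (Pi.single (0 : Fin 4) ((s : ℕ) : ZMod L)) 0 1)).trace.re)) - wilsonExpectation r.ρ β (fun U : GaugeConfig 4 L G => (r.N : ℝ) - (r.ρ (plaquetteHolonomy U 0 0 1)).trace.re) * wilsonExpectation r.ρ β (fun U : GaugeConfig 4 L G => (r.N : ℝ) - (r.ρ (plaquetteHolonomy U (Pi.single (0 : Fin 4) ((s : ℕ) : ZMod L)) 0 1)).trace.re) := by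
  intro L _ β hβ s
  exact (stub_longCovNonnegSymm L r.N G r.ρ r.continuous β hβ _ rfl).1 s

/-- **The longitudinal profile of a lattice representation is non-increasing on `[1, L/2]`**: for every torus, `β ≥ 0` and
`1 ≤ k ≤ n ≤ L/2`: `Cov_{L,β}(P_0^{01}, P_{n e₀}^{01}) ≤ Cov_{L,β}(P_0^{01}, P_{k e₀}^{01})` — transfer-matrix monotonicity of the longitudinal
profile from reflection positivity alone (`stub_longCovNonnegSymm`, `stub_longLogConvex`, `stub_antitoneOfLogConvex`). [folklore] -/
theorem longCovAntitone_rep {G : Type} [Group G] [TopologicalSpace G] [IsTopologicalGroup G] [CompactSpace G]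
    [MeasurableSpace G] [BorelSpace G] (r : LatticeRep G) :
    ∀ (L : ℕ) [NeZero L] (β : ℝ), 0 ≤ β → ∀ k n : ℕ, 1 ≤ k → k ≤ n → 2 * n ≤ L → wilsonExpectation r.ρ β (fun U : GaugeConfig 4 L G => ((r.N : ℝ) - (r.ρ (plaquetteHolonomy U 0 0 1)).trace.re) * ((r.N : ℝ) - (r.ρ (plaquetteHolonomy U (Pi.single (0 : Fin 4) ((n : ℕ) : ZMod L)) 0 1)).trace.re)) - wilsonExpectation r.ρ β (fun U : GaugeConfig 4 L G => (r.N : ℝ) - (r.ρ (plaquetteHolonomy U 0 0 1)).trace.re) * wilsonExpectation r.ρ β (fun U : GaugeConfig 4 L G => (r.N : ℝ) - (r.ρ (plaquetteHolonomy U (Pi.single (0 : Fin 4) ((n : ℕ) : ZMod L)) 0 1)).trace.re) ≤ wilsonExpectation r.ρ β (fun U : GaugeConfig 4 L G => ((r.N : ℝ) - (r.ρ (plaquetteHolonomy U 0 0 1)).trace.re) * ((r.N : ℝ) - (r.ρ (plaquetteHolonomy U (Pi.single (0 : Fin 4) ((k : ℕ) : ZMod L)) 0 1)).trace.re)) - wilsonExpectation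 r.ρ β (fun U : GaugeConfig 4 L G => (r.N : ℝ) - (r.ρ (plaquetteHolonomy U 0 0 1)).trace.re) * wilsonExpectation r.ρ β (fun U : GaugeConfig 4 L G => (r.N : ℝ) - (r.ρ (plaquetteHolonomy U (Pi.single (0 : Fin 4) ((k : ℕ) : ZMod L)) 0 1)).trace.re) := by
  intro L _ β hβ k n hk hkn hn
  obtain ⟨h0, hsymm⟩ := stub_longCovNonnegSymm L r.N G r.ρ r.continuous β hβ _ rfl
  have hlc := stub_longLogConvex L r.N G r.ρ r.continuous β hβ _ rfl
  exact stub_antitoneOfLogConvex L _ h0 hsymm hlc k n hk hkn hn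

/-- **v6 bridge at fixed data.** `AFProfilesCoreAt r → AFProfilesBigAt r` for every compact group `G` and lattice representation `r`:
the upper transverse / longitudinal profile clauses on the top range `L/8 < s ≤ L/2` are supplied by reflection positivity
(antitone, non-negative profiles) from the interior clauses at `s₀ = ⌊L/8⌋` (`stub_coreBridge`). -/
theorem afProfilesBigAt_of_afProfilesCoreAt {G : Type} [Group G] [TopologicalSpace G] [IsTopologicalGroup G] [CompactSpace G]
    [MeasurableSpace G] [BorelSpace G] (r : LatticeRep G) (h : AFProfilesCoreAt r) : AFProfilesBigAt r :=
  stub_coreBridge G r (longCovNonneg_rep r) (longCovAntitone_rep r) h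

/-- **v6 bridge (universal closure).** `AFProfilesCore → AFProfilesBig`. -/
theorem afProfilesBig_of_afProfilesCore (h : AFProfilesCore) : AFProfilesBig :=
  fun G _ _ _ _ _ _ hG r => afProfilesBigAt_of_afProfilesCoreAt r (h G hG r)

/-- **Reduction at fixed data, v6.** `AFProfilesCoreAt r → SmallTorusVarianceLawAt r → CruxCAt r` for every compact group `G` and
lattice representation `r`. -/
theorem cruxCAt_of_core_of_small {G : Type} [Group G] [TopologicalSpace G] [IsTopologicalGroup G] [CompactSpace G]
    [MeasurableSpace G] [BorelSpace G] (r : LatticeRep G) (hcore : AFProfilesCoreAt r)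
    (hsmall : SmallTorusVarianceLawAt r) : CruxCAt r :=
  cruxCAt_of_big_of_small r (afProfilesBigAt_of_afProfilesCoreAt r hcore) hsmall

/-- **Registered sub-goal `femtoCurvatureTwoPointC_of_core_of_small` (crux stmt-QuantumFields-16204, line `Sketch`, v6): the crux
follows from the interior-profile physics statement and the small-torus variance law.**
`AFProfilesCore → SmallTorusVarianceLaw → FemtoCurvatureTwoPointC` — the closing theorem for the crux once the registered physics stub
`stub_afProfilesCore` (= `AFProfilesCore`, `afProfilesCore_iff_stub`) is proved and the named fact `WilsonPartitionRegularVariation` is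
discharged (`smallTorusVarianceLaw_of_RV`):
`femtoCurvatureTwoPointC_of_core_of_small X (smallTorusVarianceLaw_of_RV WilsonPartitionRegularVariation_holds)`. -/
theorem femtoCurvatureTwoPointC_of_core_of_small :
    AFProfilesCore → SmallTorusVarianceLaw →
      Summit.QuantumFields.YangMills.Theses.LangevinControlUV.FemtoCurvatureTwoPointC :=
  fun hcore hsmall => femtoCurvatureTwoPointC_of_big_of_small (afProfilesBig_of_afProfilesCore hcore) hsmall

end Summit.QuantumFields.YangMills.Theorems.FemtoCurvatureTwoPointC

end
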